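import Mathlib
import HarnessLib
import HarnessLib.Audit
import Summits.Parity.Statement
import Literature.NumberTheory.LFunctions.NoRealZeroUpTo
import Literature.NumberTheory.LFunctions.RealCharacterLadderLeaves
import Literature.NumberTheory.LFunctions.NoRealZeroSmallModuli
import HarnessLib.Audit.Status.Attr

/-!
Route: RealCharacterDecadeTen

DORMANT since 2026-09-01T22:40:10Z (reconciler: no traction for 5 d (last activity item-evidence-added at 2026-08-27T21:50:51Z); parked, not closed — `ledger route dormant route-Parity-RealCharacterDecadeTen --off` to reactivate) — unstaffed, not closed; items shared with open routes are served there. `ledger route dormant <id> --off` reactivates.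

# Route RealCharacterDecadeTen — no real zero for every ODD quadratic primitive χ mod q ≤ 10¹⁰ (33×
Watkins), by two certified decade blocks on top of the 10⁹ ladder

X = "for every modulus 3 ≤ q ≤ 10¹⁰, every primitive quadratic ODD Dirichlet character χ mod q
(χ(−1) = −1, i.e. χ = χ_d with d < 0, |d| = q) and every real σ ∈ (0,1), L(σ,χ) ≠ 0"
= the rung leaf `Literature.NumberTheory.LFunctions.NoRealZeroOddUpTo_1e10` (body `NoRealZeroOddUpTo
10000000000`; D-0061 alt-closer
'closes rung F-P2c of Parity' once listed). It suffices to show five range blocks X = R0 ∧ R1odd ∧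
R2odd ∧ R3lo ∧ R3hi: the three
blocks of the sibling route RealCharacterThetaLadder restricted to odd characters (R0 = q ≤ 4·10⁵
Platt's range, R1odd = 4·10⁵ < q ≤ 10⁸
inside Watkins' theorem, R2odd = 10⁸ < q ≤ 10⁹ two-lineage certified V32/V34 — SHARED items, same
signatures) and the two NEW decade blocks
R3lo = 10⁹ < q ≤ 6.432·10⁹ (board cells s1–s5, lineages A ∧ BW) and R3hi = 6.432·10⁹ < q ≤ 10¹⁰
(cells s6–s10, lineages C ∧ BW), cut at
the lineage boundary of the cell's SWEEP-BOARD so that each item books exactly when its cells book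
(R-1: two referee-signed code-disjoint
lineages per cell). D-0059 route OF RECORD for the odd half of the DATA decade of cell
parity-realchar (SIEGEL INSTRUMENT, D-0070: exclusion
sweep to ≥ 100× print); the blocks are decided by certified numerics, not kernel proof, and carry
that currency label.
Lean: `Literature.NumberTheory.LFunctions.NoRealZeroOddUpTo 10000000000`

## Assembly
Pure logic: range split q ≤ 4·10⁵ ∨ 4·10⁵ < q ≤ 10⁸ ∨ 10⁸ < q ≤ 10⁹ ∨ 10⁹ < q ≤ 6.432·10⁹ ∨
6.432·10⁹ < q ≤ 10¹⁰ (`omega`); the deciding theorem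
`closes` (glue-C.lean; farm rc 0, 0 sorries in the seat's SketchC.lean) concludes the leaf
`NoRealZeroOddUpTo_1e10` (= `NoRealZeroOddUpTo 10000000000`).

CLOSES_TARGET: closes rung F-P2c of Parity: Literature.NumberTheory.LFunctions.NoRealZeroOddUpTo_1e10 (D-0061; not the summit Statement) — the deciding theorem of this route concludes that registered leaf instead of the Statement decl `GeneralizedHardyLittlewood` (class rung: servable and labelled, never counted as concluding the summit Statement).

Rationale: WHY THIS LINE. Mechanism (unchanged from the 10⁹ ladder): a real zero σ ∈ (0,1) of L(s,χ_d) is a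
zero of the completed function Λ_d(σ) = ξ(σ,χ_d), a
theta integral whose positivity on [0,1] is decidable row by row by certified evaluation — lineage A
(Taylor models of the Hecke theta
series at 1/2 with a Lagrange majorant, Arb tables), lineage BW regime 3 (integer-only
Bernstein/Chebyshev panel enclosures with an
in-job regime-1 second pass), lineage C (integer-only, two-end batch interpolation + per-row exact
retry, independently generated tables
cross-validated against A's); tree criterion `noRealZeroUpTo_iff_dirichletXi_re_pos` (p403290).
Print for odd characters stops at
|d| ≤ 3·10⁸ (Watkins2004RealZeros, single implementation); Lu–Zaman–Zhao 2026 (arXiv:2602.03626 Thm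
1.1) reach 10¹⁰ only in the NARROW
window σ ≥ 1 − 1/(5 log q); Platt2016GRH covers q ≤ 4·10⁵. What this route does that the 10⁹ route
does not: it types the decade
(10⁹,10¹⁰] — 33× Watkins wide, the same height as LZZ's narrow theorem but for the whole interval
(0,1) — as two booking blocks aligned
with the cell's lineage map, so the odd leaf closes the moment the board's odd column is contiguous,
and the wide leaf `NoRealZeroUpTo_1e10`
follows by `noRealZeroUpTo_1e10_iff_odd_and_even` from this leaf and an even sibling. Nothing is
imported from another area; no new
mathematics is claimed; consumers take the leaf as a hypothesis (`NoRealZeroOddUpTo.anti_level`,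
central-value positivity lemmas).

RANKED CRUXES. #2 OddHighDecade (crux) — for every modulus 6.432·10⁹ < q ≤ 10¹⁰, every primitive
quadratic ODD χ mod q and every σ ∈ (0,1), L(σ,χ) ≠ 0 (1 084 541 870 fundamental d < 0, two
independent Möbius counts; board cells s6–s10; DATA lineage C kit j247537 (s6+s7) / j247538 (s8–s10)
running, lineage BW regime 3 odd j247454 (upper part) / j247455 running; currency: certified
numerics, two code-disjoint integer-only lineages, referee-signed per cell). [difficulty: L] (why it
might fail: false iff an odd d with 6.432·10⁹ < |d| ≤ 10¹⁰ has a real zero; evidence-side, lineage C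
is the newest implementation (STEP-0 V53 at 4·10⁵ only) and its batch interpolation error grows with
q — a value-level C-vs-BW disjoint pair at this height would void the block's certificate.)
[Watkins2004RealZeros, arXiv:2602.03626, Platt2016GRH]
#3 OddLowDecade (crux) — for every modulus 10⁹ < q ≤ 6.432·10⁹, every primitive quadratic ODD χ mod
q and every σ ∈ (0,1), L(σ,χ) ≠ 0 (1 651 130 063 fundamental d < 0; board cells s1–s5; DATA lineage
A kit j246986–j246992 (s1), j247077–j247082 (s2), j247343–j247499 (s3), j247360/364/365 (s4),
j247367/387/388 (s5) running, lineage BW regime 3 odd j247453 / j247454 (lower part) running,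
lineage C s1 DONE 01:17Z (469 927 691 rows ALL_CERTIFIED); currency: certified numerics, ≥ two
code-disjoint lineages per cell, referee-signed). [difficulty: L] (why it might fail: false iff an
odd d with 10⁹ < |d| ≤ 6.432·10⁹ has a real zero; in practice odd Λ_d(1/2) is smallest for d with
many small split primes, where lineage A's K = 30 Taylor order may not sign the row and a per-row
deeper recheck (A′) is needed before the cell books.) [Watkins2004RealZeros, Platt2016GRH,
arXiv:2602.03626]
#4 OddToBillion (crux) — for every modulus 10⁸ < q ≤ 10⁹, every primitive quadratic ODD χ mod q and
every σ ∈ (0,1), L(σ,χ) ≠ 0 — SHARED with route RealCharacterThetaLadder (same signature, item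
stmt-Parity-18823); DATA: two-lineage full width A + BW, referee V32/V34/V35 (607 927 069
fundamental d both parities at 10⁹); currency: certified numerics. [difficulty: L] (why it might
fail: false iff an odd d with 10⁸ < |d| ≤ 10⁹ has a real zero; printed only to 3·10⁸ (Watkins, one
implementation), so 3·10⁸ < |d| ≤ 10⁹ rests on the cell's two lineages alone.)
[Watkins2004RealZeros, Platt2016GRH, arXiv:2602.03626]
#9 PlattRange (support) — no real zero in (0,1) for every primitive quadratic χ mod 3 ≤ q ≤ 4·10⁵,
both parities — Platt's printed range (tree `noRealZeroUpTo_platt` modulo the named facts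
`platt2016_theorem71/72`) and the cell's STEP-0 (three code-disjoint certified lineages A/BW/C, 243
171/243 171 fundamental d, referee STEP0-PASS / STEP0-W-PASS / V53); SHARED with route
RealCharacterThetaLadder (item stmt-Parity-18824); kernel sub-range `noRealZeroUpTo_twentyThree`
(p403994). [difficulty: XL] [Platt2016GRH, Watkins2004RealZeros, Chua2005RealZeros]
#9 OddToHundredMillion (support) — for every modulus 4·10⁵ < q ≤ 10⁸, every primitive quadratic ODD
χ mod q and every σ ∈ (0,1), L(σ,χ) ≠ 0 — inside Watkins' printed theorem (`watkins2004_theorem` +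
`NoRealZeroOddUpTo.anti_level`, named fact) and reproduced by DATA lineage A R1 (PASS V13); SHARED
with route RealCharacterThetaLadder (item stmt-Parity-18825). [difficulty: XL]
[Watkins2004RealZeros]

TWO-LAYER PLAN. Foreseen glued split of each decade block into its board cells only if a cell stalls
(OddLowDecade ⇐ s1 → s2 → s3 → s4 → s5, boundaries
2.546/3.703/4.699/5.599 ·10⁹; OddHighDecade ⇐ s6–s7 → s8–s10, boundary 7.955·10⁹) — nothing filed
now; cells are engine bookkeeping on
HOME/SWEEP-BOARD.md. When the EVEN decade books, the even sibling (EvenLowDecade/EvenHighDecade over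
the 10⁹ route's even items) closes
`NoRealZeroEvenUpTo_1e10`, and `NoRealZeroUpTo_1e10` follows by
`noRealZeroUpTo_1e10_iff_odd_and_even` (tree, p415610). The next rung
(10¹⁰, 3·10¹⁰] odd (board §4, tiles t1–t12, C ∧ BW) becomes one more block → leaf
`NoRealZeroOddUpTo_3e10` (to be filed).

KILL CRITERIA. A certified real zero (an interval on which Λ_d < 0 for some odd d with |d| ≤ 10¹⁰,
reproduced by a second lineage) refutes the block
containing d, closes the route `refuted:<Block>`, and is a counterexample to Chowla's conjecture. A
referee GAP verdict on a decade cell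
(disjoint value-level enclosures between its two lineages, or an UNCERTIFIED row surviving the
per-row retry and the A′ deep recheck) that is
not repaired inside the cell's envelope (5 500 core-h) forces re-pointing at the 10⁹ leaf (i.e. this
route goes dormant, the sibling stands).

NOT DECOMPOSED YET. No per-cell, per-batch or per-discriminant items (10 cells, ≈ 10⁵ batches):
bookkeeping lives on HOME/SWEEP-BOARD.md and DATA.md. No
items for the even decade (separate sibling when it books), for the ξ-positivity form of the blocks
(equivalent by
`noRealZeroUpTo_iff_dirichletXi_re_pos`), for the central-value enclosures / near-miss table
(HOME/NEAR-MISS data, not statements), or for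
consumers (C1/C2/C4/C5 lemmas are in the tree and take the leaf as hypothesis). No kernel replay of
any decade row is planned.

CHEAPEST FALSIFIER. The STEP-0-at-height join: certify one 10⁶-wide odd window at the TOP of the
decade, [9 999 000 000, 10 000 000 001) (303 980 rows), with
two code-disjoint lineages and join the Λ_d(1/2) enclosures value by value — one disjoint pair kills
the evidence for OddHighDecade (not
the statement) and sends both lineages to audit. Already run: lineage A top window both signs
(j246605, 364 762 odd rows ALL_CERTIFIED),
lineage C STEP-0 V53, BW regime-3 STEP-0 V54; the decade-wide joins happen per cell at booking.

NUMBERS. Printed wide frontier (odd): |d| ≤ 3·10⁸ (Watkins2004RealZeros, Theorem p. 416); even q ≤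
4·10⁵ (Platt2016GRH Thms 7.1–7.2). Narrow:
σ ≥ 1 − 1/(5 log q), all quadratic χ, q ≤ 10¹⁰ (arXiv:2602.03626 Thm 1.1, ≈ 150k core-h). Cell:
N₋(10⁹) = 303 963 510, N₋(6.432·10⁹) =
1 955 093 573, N₋(10¹⁰) = 3 039 635 443 (two independent Möbius counters) ⇒ OddLowDecade 1 651 130
063 rows, OddHighDecade 1 084 541 870
rows; decade budget ≤ 2 200 core-h all-in of the realchar envelope 5 500 (board R-9); record small
central values at 10⁹:
L(½,χ_d) = 1.28·10⁻⁶ (d = −175 990 483).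

DEFINITION REQUESTS. None. The leaf `Literature.NumberTheory.LFunctions.NoRealZeroOddUpTo_1e10 :
Prop := NoRealZeroOddUpTo 10000000000` is landed (p415610,
RealCharacterLadderLeaves.lean :88) together with `NoRealZeroEvenUpTo_1e10`, `NoRealZeroUpTo_1e10`,
`noRealZeroUpTo_1e10_iff_odd_and_even`,
`NoRealZeroUpTo_1e10.to_1e9`.

Novelty: Searches (2026-08-25/26, inherited from the sibling filing and re-run for the decade): lit search
--hybrid "real zeros of quadratic Dirichlet L-functions verified computation discriminant" (textbook
hits only: Montgomery–Vaughan 2007 p.109, Cohen 1993, Buell 1989); lit search "Landau-Siegel zeros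
numerical computations" --source all (local: arXiv:2602.03626 pp.1,16,20; arXiv:2301.10722 p.9;
remote: doi:10.1016/j.jnt.2023.04.008, doi:10.1090/mcom/4268, Sarnak–Zaharescu 2002); lit galaxy
search "real zeros of real|Landau-Siegel zero|no Siegel zero" --star all (21 rows, none a
verification table beyond Watkins/Platt/LZZ; pdf:199087960 Stopple = context); lit read
arxiv:2301.10722 --grep (p.3: "Watkins … q ≤ 3·10⁸ odd, Platt … even q ≤ 4·10⁵").
Nearest prior art found: Watkins2004RealZeros (odd, |d| ≤ 3·10⁸, Low's criterion, one
implementation) [corpus: tree NoRealZeroPrintedFrontier.lean cite]; arXiv:2602.03626 Thm 1.1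
[corpus:arxiv-2602.03626 p.1] (q ≤ 10¹⁰ but NARROW σ ≥ 1 − 1/(5 log q)); Platt2016GRH Thms 7.1–7.2
(q ≤ 4·10⁵); arXiv:2301.10722 Thm 1 [corpus:arxiv-2301.10722 p.3] (prime q ≤ 10⁷, even, narrow,
non-certified).
Delta: the odd wide column moves from 3·10⁸ (print, one implementation) to 10¹⁰ with at least two
code-disjoint certified lineages per cell, typed as two booking blocks over the 10⁹ ladder; no new
mathematics is claimed.
Claimed grade: variant  [refs: 10.1016/j.jnt.2023.04.008, 10.1090/mcom/4268, 2602.03626, 2301.10722, doi:10.1016/j.jnt.2023.04.008, doi:10.1090/mcom/4268, arxiv:2301.10722, arxiv-2602.03626, arxiv-2301.10722]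

Barriers (technique_class: certified-numerics, theta-positivity, interval-arithmetic): - technique_class: certified-numerics, theta-positivity, interval-arithmetic
- Literature.Barriers.Parity.SiegelZeroTwinPrimes: it does not touch it and does not try — a finite
table (q ≤ 10¹⁰) implies nothing about Siegel zeros of unbounded quality or about twin primes (H4/H5
of the cell); the route is an instrument (explicit exclusion for q ≤ Q), not a summit move.
- Literature.Barriers.Parity.SiegelZeroPrimePairBarrier: outside its class — no shift-uniform
prime-pair bound is claimed or used; the only output is L(σ,χ_d) ≠ 0 on (0,1) for odd |d| ≤ 10¹⁰,
which the barrier neither forbids nor is fed by.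
- Literature.Barriers.Parity.BrunTitchmarshSiegelZero: not in its class (no sieve bound is improved;
nothing asymptotic is claimed). (Uncatalogued for Parity but governing the method: the
Epstein/class-sum kernel method
`Literature/Barriers/RiemannHypothesis/EpsteinZetaRealZerosSmallK.lean` is blocked from d ≥ 200 by
its own scope statement — hence certified numerics, not kernel, above |d| = 144.)
- Negatives index: empty for these statements at filing (no refuted `NoRealZero*` /
`NoExceptionalZero*` instance in `ledger negatives --problem Parity`, 4 unrelated Parity negatives;
the A1 episode — `NoExceptionalZeroUpTo` without `0 < σ` false via L(−1,χ₃) = 0 — is built into the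
landed definitions).

History (route lifecycle, newest last):
- 2026-09-01T22:40:10Z · DORMANT — reconciler: no traction for 5 d (last activity item-evidence-added at 2026-08-27T21:50:51Z); parked, not closed — `ledger route dormant route-Parity-RealCharact (operator:999:238631)

sub-problem: GeneralizedHardyLittlewood · status: dormant · opened planner-parity-realchar-theory-g5-0 2026-08-26T02:10:45Z · rev 1 · ledger route-Parity-RealCharacterDecadeTen
GENERATED by the gate from the ledger (D-0016/17). Provers cite these decls: `theorem foo : Summit.Parity.GeneralizedHardyLittlewood.Theses.RealCharacterDecadeTen.<Decl> := …` in Summits/Parity/GeneralizedHardyLittlewood/Theorems/<Name>.lean.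
-/

namespace Summit.Parity.GeneralizedHardyLittlewood.Theses.RealCharacterDecadeTen

open scoped BigOperators Topology Manifold Classical MeasureTheory ProbabilityTheory Matrix InnerProductSpace ComplexConjugate ContinuousMap
open Filter Set Function TopologicalSpace MeasureTheory

attribute [summit_statement] _root_.GeneralizedHardyLittlewood
attribute [summit_statement] _root_.Literature.NumberTheory.LFunctions.NoRealZeroOddUpTo_1e10

/-- item stmt-Parity-19295 · crux · rank 2 · open · by planner
why it might fail: false iff an odd d with 6.432·10⁹ < |d| ≤ 10¹⁰ has a real zero; evidence-side, lineage C is the newest implementation (STEP-0 V53 at 4·10⁵ only) and its batch interpolation error grows with q — a value-level C-vs-BW disjoint pair at this height would void the block's certificate.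
sources: Watkins2004RealZeros, arXiv:2602.03626, Platt2016GRH
[crux] for every modulus 6.432·10⁹ < q ≤ 10¹⁰, every primitive quadratic ODD χ mod q and every σ ∈
(0,1), L(σ,χ) ≠ 0 (1 084 541 870 fundamental d < 0, two independent Möbius counts; board cells
s6–s10; DATA lineage C kit j247537 (s6+s7) / j247538 (s8–s10) running, lineage BW regime 3 odd
j247454 (upper part) / j247455 running; currency: certified numerics, two code-disjoint integer-only
lineages, referee-signed per cell). [difficulty: L] -/
@[route_item "route-Parity-RealCharacterDecadeTen", crux]
def OddHighDecade : Prop :=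
  ∀ (q : ℕ) [NeZero q], 6432000000 < q → q ≤ 10000000000 → ∀ χ : DirichletCharacter ℂ q, χ.IsQuadratic → χ.IsPrimitive → χ.Odd → ∀ σ : ℝ, 0 < σ → σ < 1 → χ.LFunction σ ≠ 0

/-- item stmt-Parity-19296 · crux · rank 3 · open · by planner
why it might fail: false iff an odd d with 10⁹ < |d| ≤ 6.432·10⁹ has a real zero; in practice odd Λ_d(1/2) is smallest for d with many small split primes, where lineage A's K = 30 Taylor order may not sign the row and a per-row deeper recheck (A′) is needed before the cell books.
sources: Watkins2004RealZeros, Platt2016GRH, arXiv:2602.03626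
[crux] for every modulus 10⁹ < q ≤ 6.432·10⁹, every primitive quadratic ODD χ mod q and every σ ∈
(0,1), L(σ,χ) ≠ 0 (1 651 130 063 fundamental d < 0; board cells s1–s5; DATA lineage A kit
j246986–j246992 (s1), j247077–j247082 (s2), j247343–j247499 (s3), j247360/364/365 (s4),
j247367/387/388 (s5) running, lineage BW regime 3 odd j247453 / j247454 (lower part) running,
lineage C s1 DONE 01:17Z (469 927 691 rows ALL_CERTIFIED); currency: certified numerics, ≥ two
code-disjoint lineages per cell, referee-signed). [difficulty: L] -/
@[route_item "route-Parity-RealCharacterDecadeTen", crux]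
def OddLowDecade : Prop :=
  ∀ (q : ℕ) [NeZero q], 1000000000 < q → q ≤ 6432000000 → ∀ χ : DirichletCharacter ℂ q, χ.IsQuadratic → χ.IsPrimitive → χ.Odd → ∀ σ : ℝ, 0 < σ → σ < 1 → χ.LFunction σ ≠ 0

/-- item stmt-Parity-18823 · crux · rank 4 · open · by planner
why it might fail: false iff an odd d with 10⁸ < |d| ≤ 10⁹ has a real zero; printed only to 3·10⁸ (Watkins, one implementation), so 3·10⁸ < |d| ≤ 10⁹ rests on the cell's two lineages alone.
sources: Watkins2004RealZeros, Platt2016GRH, arXiv:2602.03626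
for every modulus 10⁸ < q ≤ 10⁹, every primitive quadratic ODD χ mod q and every σ ∈ (0,1), L(σ,χ) ≠
0 (printed to 3·10⁸ by Watkins, single lineage; new for 3·10⁸ < q ≤ 10⁹). BOOKED in the route's
currency (certified numerics, two code-disjoint referee-signed lineages; text refreshed 2026-08-26
per tribunal №10 (4), statement unchanged): lineage A regime 2 (referee V34 PASS) ∧ lineage BW R2-W
odd (kit j244998/j245000/j245001/j245003; referee V35 PASSED — supersedes the earlier «BW odd R2-W
unfunded» wording; odd record rows with two-sided BW positivity, V32-A). Closing bundle attached to
stmt-Parity-18823; the item stays OPEN+BOOKED (D1–D3) and closes in the ledger sense only on a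
kernel replay. -/
@[route_item "route-Parity-RealCharacterDecadeTen", crux]
def OddToBillion : Prop :=
  ∀ (q : ℕ) [NeZero q], 100000000 < q → q ≤ 1000000000 → ∀ χ : DirichletCharacter ℂ q, χ.IsQuadratic → χ.IsPrimitive → χ.Odd → ∀ σ : ℝ, 0 < σ → σ < 1 → χ.LFunction σ ≠ 0

/-- item stmt-Parity-18824 · support · rank 9 · open · by planner
sources: Platt2016GRH, Watkins2004RealZeros, Chua2005RealZeros
no real zero in (0,1) for every primitive quadratic χ mod 3 ≤ q ≤ 4·10⁵, both parities — Platt's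
printed range. RESIDUAL of the route (tribunal №10: tier B on the leaf modulo [PlattRange,
OddToHundredMillion]); CLOSING CURRENCY stated for consumers of NoRealZeroUpTo_1e9 (text refreshed
2026-08-26 per №10 (3), statement unchanged): (i) PRINT, conditional in the kernel — tree
`noRealZeroUpTo_platt` modulo the NAMED FACTS `platt2016_theorem71` / `platt2016_theorem72` (Platt,
Math. Comp. 85 (2016) Thms 7.1/7.2: GRH to height 10⁸/q for primitive χ, q ≤ 4·10⁵ ⇒ no real zero);
(ii) CERTIFIED NUMERICS — the cell's STEP-0: two code-disjoint integer-certified lineages A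
(certify.py, kit j241268) and BW (bwcert, j242447) over all 243 171 fundamental d with 3 ≤ |d| ≤
4·10⁵, referee-signed STEP0-PASS / STEP0-W-PASS with a full value-level join (0 disjoint, worst
separation 0.0244 at d = −907), and lineage C's in-job STEP-0 guards (V59/V68); (iii) KERNEL,
unconditional, sub-ranges only — `noRealZeroUpTo_twentyThree` (q ≤ 23, p403994),
`noRealZeroOddUpTo_144` (odd q ≤ 144, Epstein class sums), the Fekete–Pólya / Chowla files
(registered skeleton stubs in the decade routes). So a consumer reads: « -/
@[route_item "route-Parity-RealCharacterDecadeTen", crux]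
def PlattRange : Prop :=
  Literature.NumberTheory.LFunctions.NoRealZeroUpTo 400000

/-- item stmt-Parity-18825 · support · rank 9 · open · by planner
sources: Watkins2004RealZeros
for every modulus 4·10⁵ < q ≤ 10⁸, every primitive quadratic ODD χ mod q and every σ ∈ (0,1), L(σ,χ)
≠ 0 — inside Watkins' printed theorem. RESIDUAL of the route (tribunal №10); CLOSING CURRENCY stated
for consumers (text refreshed 2026-08-26 per №10 (3), statement unchanged): (i) PRINT, conditional
in the kernel — the NAMED FACT `watkins2004_theorem` (Watkins, Math. Comp. 73 (2004) 415–423: no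
real zero σ > 0 for odd real primitive χ_d, |d| ≤ 3·10⁸) + the PROVED monotonicity
`NoRealZeroOddUpTo.anti_level`; (ii) CERTIFIED NUMERICS — reproduced by lineage A regime 1 (kit
j241631/j241633, referee V13 PASS: the odd half of the 60 792 709-row R1 campaign), ONE certified
lineage (the cell bought no second lineage inside print for odd R1; BW R1-W covered the even side).
So a consumer reads: «modulo watkins2004_theorem (print) — reproduced once by certified numerics (A
R1, V13)». -/
@[route_item "route-Parity-RealCharacterDecadeTen", crux]
def OddToHundredMillion : Prop :=
  ∀ (q : ℕ) [NeZero q], 400000 < q → q ≤ 100000000 → ∀ χ : DirichletCharacter ℂ q, χ.IsQuadratic → χ.IsPrimitive → χ.Odd → ∀ σ : ℝ, 0 < σ → σ < 1 → χ.LFunction σ ≠ 0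

/-- item stmt-Parity-19297 · assembly · rank 1 · open · by planner
sources: Watkins2004RealZeros
[assembly] PlattRange → OddToHundredMillion → OddToBillion → OddLowDecade → OddHighDecade → no real
zero for odd quadratic χ up to 10¹⁰. -/
@[route_item "route-Parity-RealCharacterDecadeTen"]
def Assembly : Prop :=
  PlattRange → OddToHundredMillion → OddToBillion → OddLowDecade → OddHighDecade → Literature.NumberTheory.LFunctions.NoRealZeroOddUpTo 10000000000

/-! D-0027 §2.1 — DECIDING THEOREM (planner-authored via `route open/edit --closes-file`; by planner-parity-realchar-theory-g5-0 2026-08-26T02:10:45Z):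
its hypotheses are this route's items and its conclusion the registered leaf `Literature.NumberTheory.LFunctions.NoRealZeroOddUpTo_1e10` (rung F-P2c, D-0061) (glue_lint), and it elaborates with this file. -/

@[closes "route-Parity-RealCharacterDecadeTen"] theorem closes (h0 : PlattRange) (h1o : OddToHundredMillion) (h2o : OddToBillion)
    (h3lo : OddLowDecade) (h3hi : OddHighDecade) :
    Literature.NumberTheory.LFunctions.NoRealZeroOddUpTo_1e10 := by
  show Literature.NumberTheory.LFunctions.NoRealZeroOddUpTo 10000000000
  intro q _ hq3 hqQ χ hquad hprim hodd σ hσ0 hσ1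
  by_cases hq0 : q ≤ 400000
  · exact h0 q hq3 hq0 χ hquad hprim σ hσ0 hσ1
  · by_cases hq1 : q ≤ 100000000
    · exact h1o q (by omega) hq1 χ hquad hprim hodd σ hσ0 hσ1
    · by_cases hq2 : q ≤ 1000000000
      · exact h2o q (by omega) hq2 χ hquad hprim hodd σ hσ0 hσ1
      · by_cases hq4 : q ≤ 6432000000
        · exact h3lo q (by omega) hq4 χ hquad hprim hodd σ hσ0 hσ1
        · exact h3hi q (by omega) hqQ χ hquad hprim hodd σ hσ0 hσ1

end Summit.Parity.GeneralizedHardyLittlewood.Theses.RealCharacterDecadeTen
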